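import Summits.Parity.BatemanHorn.Theorems.AlmostPrimeZerosSystemLSDRealSegmentClasses
import Summits.Parity.BatemanHorn.Theorems.AlmostPrimeZerosSystemLSDRealSegmentRoughKernelReduction
import Summits.Parity.BatemanHorn.Theorems.AlmostPrimeZerosSystemLSDRealSegmentSmoothKernel

/-!
# Line `beta-thinned-root-kernel` — checked skeleton for crux `SystemLSDRealSegment`
(item stmt-Parity-11292, route `AlmostPrimeZeros`, sub-problem `BatemanHorn`) — LEAD'S INTEGRATION (rev L5b, lead c9)

Crux (by name, concluded by `SystemLSDRealSegment_of` below):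
`Summit.Parity.BatemanHorn.Theses.AlmostPrimeZeros.SystemLSDRealSegment`.

STATUS.  Revs L1–L4 (leads -0, c1, c2): the crux is EQUIVALENT, family by family and point by point, to the kernel law
`BetaKernelLaw k f y` (beyond-level-`x` divisor tuples, forced constant `λ_f(y)(D^{y−1}Γ(y)^{−k} − Γ(k(y−1)+1)^{−1})`),
landed reduction `systemLSDRealSegment_of_betaKernelLaw` + case split `betaKernelLaw_of_classes`; `k = 0`, `k = 1` linear,
the Type-I half and `H_x(y) ≍ 1` (lead c8, Nair–Tenenbaum light) are theorems.

REV L5 (lead c9) LOCALISES THE KERNEL TO ROUGH TUPLES: `K_x(y) = K^{sm}_x(y;S) + K^{rough}_x(y;S)` at the height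
`S = ⌊x^θ⌋₊ + 1` (tuples whose product is `S`-smooth / has a prime factor `≥ S`).  LANDED in rev L5a → L5b (all
`--supports stmt-Parity-11292`): the smooth part is NEGLIGIBLE, `K^{sm}_x(y;⌊x^θ⌋₊+1) ≤ C e^{−1/θ} x (log x)^{k(y−1)}` for every
Bateman–Horn system, every real `y ≥ 1`, every `θ ∈ (0,1]` (`stub_smoothKernel_negligible`, file `…SmoothKernel.lean`, from
`…SmoothTailRankin` (Rankin, pointwise), `…TwistedDomination` (one multiplicative majorant of the product value),
`…TwistedMertens` (twisted Mertens exponent) and `nairTenenbaumLight`); the glue `betaKernelLaw_of_roughLaw` /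
`roughLaw_of_betaKernelLaw` (`…RoughKernelReduction.lean`): `BetaKernelLaw k f y` ⇔ the ROUGH part obeys the law up to every
`ε` for all small `θ`.  Companion (landed): the `y`-tilted Kubilius model at height `x^θ` (`…TruncatedLawCore/…TruncatedLaw.lean`: the
law of the truncated statistic, constant `Re λ_f(y) (e^γ θ)^{k(y−1)}`), the equivalence `betaKernelLaw_iff_tiltedRoughLaw`
(`…TiltedRoughLaw.lean`: each open stub ⇔ the `y`-tilted exponential moment of the number of prime factors `> x^θ` tends to
`e^{−γk(y−1)} D^{y−1} Γ(y)^{−k} θ^{−k(y−1)}`), and the calibration `…RoughLawLinear.lean` (the stubs' shape is a THEOREM in the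
proved class `k = 1`, `deg 1`).
OPEN STUBS (the honest content, one per family class, each EXACTLY the `y`-tilted law of the prime factors `> x^θ` of the
values): `stub_roughKernel_linearPair`, `stub_roughKernel_quadratic`, `stub_roughKernel_totalDegree`.
-/

open Filter Finset Polynomial
open scoped BigOperators Topology

namespace Summit.Parity.BatemanHorn.Cruxes.SystemLSDRealSegment.BetaThinnedRootKernel

open Literature.NumberTheory.Sieve
open Summit.Parity.BatemanHorn.Theses.AlmostPrimeZeros (SystemLSDRealSegment)

noncomputable section

/-! ### Open stubs: the rough part of the kernel obeys the law (one per family class) -/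

/-- **stub_roughKernel_linearPair** (OPEN — the honest content for a Bateman–Horn PAIR OF LINEAR polynomials): for every
`ε > 0` and all small `θ > 0`, the ROUGH part of the kernel (beyond-level tuples `(d₁, d₂)`, `d₁d₂ > x`, `d₁d₂` with a prime
factor `> x^θ`) satisfies `|K^{rough}_x(y; ⌊x^θ⌋₊+1)/(x (log x)^{2(y−1)}) − Re λ_f(y)(Γ(y)^{−2} − Γ(2y−1)^{−1})| ≤ ε`
eventually: the `y`-tilted law of the prime factors `> x^θ` of `(a₁n+b₁)(a₂n+b₂)` — binary additive divisor problem for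
`τ_y`, `1 < y < 2`, not in print. [folklore] -/
theorem stub_roughKernel_linearPair :
    ∀ f : Fin 2 → ℤ[X], IsBatemanHornSystem f → (f 0).natDegree = 1 → (f 1).natDegree = 1 →
      ∀ y : ℝ, 5 / 4 < y → y < 7 / 4 → ∀ ε : ℝ, 0 < ε → ∃ θ₀ : ℝ, 0 < θ₀ ∧ ∀ θ : ℝ, 0 < θ → θ ≤ θ₀ →
        ∀ᶠ x : ℕ in atTop,
          |(∑ n ∈ range (x + 1), ∑ d ∈ (tuples f n).filter
              (fun d => x < ∏ i, d i ∧ (∏ i, d i) ∉ Nat.smoothNumbers (⌊(x : ℝ) ^ θ⌋₊ + 1)),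
                ∏ i, thinWeight y (d i)) / ((x : ℝ) * Real.log x ^ (((2 : ℕ) : ℝ) * (y - 1))) -
            (eulerFactor f (y : ℂ)).re *
              (Real.exp ((y - 1) * Real.log (∏ i, ((f i).natDegree : ℝ))) * (Real.Gamma y)⁻¹ ^ (2 : ℕ) -
                (Real.Gamma (((2 : ℕ) : ℝ) * (y - 1) + 1))⁻¹)| ≤ ε := by
  sorry

/-- **stub_roughKernel_quadratic** (OPEN — ONE IRREDUCIBLE QUADRATIC `f`): for every `ε > 0` and all small `θ > 0`, the rough
part of the kernel (cube-free `d ∣ f(n)`, `d > x`, `d` with a prime factor `> x^θ`, weight `h_y(d)`) satisfies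
`|K^{rough}_x(y; ⌊x^θ⌋₊+1)/(x (log x)^{y−1}) − Re λ_f(y)(2^{y−1}Γ(y)^{−1} − Γ(y)^{−1})| ≤ ε` eventually: the `y`-tilted law of
the prime factors `> x^θ` of `f(n)` (contains the density of `P⁺(f(n)) > x`, not known to exist). [folklore] -/
theorem stub_roughKernel_quadratic :
    ∀ f : Fin 1 → ℤ[X], IsBatemanHornSystem f → (f 0).natDegree = 2 →
      ∀ y : ℝ, 5 / 4 < y → y < 7 / 4 → ∀ ε : ℝ, 0 < ε → ∃ θ₀ : ℝ, 0 < θ₀ ∧ ∀ θ : ℝ, 0 < θ → θ ≤ θ₀ →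
        ∀ᶠ x : ℕ in atTop,
          |(∑ n ∈ range (x + 1), ∑ d ∈ (tuples f n).filter
              (fun d => x < ∏ i, d i ∧ (∏ i, d i) ∉ Nat.smoothNumbers (⌊(x : ℝ) ^ θ⌋₊ + 1)),
                ∏ i, thinWeight y (d i)) / ((x : ℝ) * Real.log x ^ (((1 : ℕ) : ℝ) * (y - 1))) -
            (eulerFactor f (y : ℂ)).re *
              (Real.exp ((y - 1) * Real.log (∏ i, ((f i).natDegree : ℝ))) * (Real.Gamma y)⁻¹ ^ (1 : ℕ) -
                (Real.Gamma (((1 : ℕ) : ℝ) * (y - 1) + 1))⁻¹)| ≤ ε := by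
  sorry

/-- **stub_roughKernel_totalDegree** (OPEN-PROBLEM — every Bateman–Horn system of TOTAL DEGREE `Σ deg fᵢ ≥ 3`): for every
`ε > 0` and all small `θ > 0`, the rough part of the kernel satisfies
`|K^{rough}_x(y; ⌊x^θ⌋₊+1)/(x (log x)^{k(y−1)}) − Re λ_f(y)(D^{y−1}Γ(y)^{−k} − Γ(k(y−1)+1)^{−1})| ≤ ε` eventually. [folklore] -/
theorem stub_roughKernel_totalDegree :
    ∀ (k : ℕ) (f : Fin k → ℤ[X]), IsBatemanHornSystem f → 3 ≤ ∑ i, (f i).natDegree →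
      ∀ y : ℝ, 5 / 4 < y → y < 7 / 4 → ∀ ε : ℝ, 0 < ε → ∃ θ₀ : ℝ, 0 < θ₀ ∧ ∀ θ : ℝ, 0 < θ → θ ≤ θ₀ →
        ∀ᶠ x : ℕ in atTop,
          |(∑ n ∈ range (x + 1), ∑ d ∈ (tuples f n).filter
              (fun d => x < ∏ i, d i ∧ (∏ i, d i) ∉ Nat.smoothNumbers (⌊(x : ℝ) ^ θ⌋₊ + 1)),
                ∏ i, thinWeight y (d i)) / ((x : ℝ) * Real.log x ^ ((k : ℝ) * (y - 1))) -
            (eulerFactor f (y : ℂ)).re *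
              (Real.exp ((y - 1) * Real.log (∏ i, ((f i).natDegree : ℝ))) * (Real.Gamma y)⁻¹ ^ k -
                (Real.Gamma ((k : ℝ) * (y - 1) + 1))⁻¹)| ≤ ε := by
  sorry

/-! ### Composition (everything below is LANDED) -/

/-- The kernel law for ONE family at ONE point from the rough law: the smooth bound is the landed
`stub_smoothKernel_negligible`, the glue is the landed `betaKernelLaw_of_roughLaw`. -/
theorem betaKernelLaw_of_roughStub {k : ℕ} {f : Fin k → ℤ[X]} (hf : IsBatemanHornSystem f) {y : ℝ} (hy : 1 ≤ y)
    (hR : ∀ ε : ℝ, 0 < ε → ∃ θ₀ : ℝ, 0 < θ₀ ∧ ∀ θ : ℝ, 0 < θ → θ ≤ θ₀ → ∀ᶠ x : ℕ in atTop,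
      |(∑ n ∈ range (x + 1), ∑ d ∈ (tuples f n).filter
          (fun d => x < ∏ i, d i ∧ (∏ i, d i) ∉ Nat.smoothNumbers (⌊(x : ℝ) ^ θ⌋₊ + 1)),
            ∏ i, thinWeight y (d i)) / ((x : ℝ) * Real.log x ^ ((k : ℝ) * (y - 1))) -
        (eulerFactor f (y : ℂ)).re *
          (Real.exp ((y - 1) * Real.log (∏ i, ((f i).natDegree : ℝ))) * (Real.Gamma y)⁻¹ ^ k -
            (Real.Gamma ((k : ℝ) * (y - 1) + 1))⁻¹)| ≤ ε) :
    BetaKernelLaw k f y := by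
  obtain ⟨C, -, hC⟩ := stub_smoothKernel_negligible k f hf y hy
  exact betaKernelLaw_of_roughLaw hf hy ⟨C, hC⟩ hR

/-- **The skeleton theorem**: the crux BY NAME from the three open rough-kernel stubs, through the LANDED glue
`betaKernelLaw_of_roughStub`, the LANDED case split `betaKernelLaw_of_classes` and the LANDED reduction
`systemLSDRealSegment_of_betaKernelLaw`. -/
theorem SystemLSDRealSegment_of : SystemLSDRealSegment :=
  systemLSDRealSegment_of_betaKernelLaw
    (betaKernelLaw_of_classes
      (fun f hf h0 h1 y hy hy' => betaKernelLaw_of_roughStub hf (by linarith)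
        (stub_roughKernel_linearPair f hf h0 h1 y hy hy'))
      (fun f hf h0 y hy hy' => betaKernelLaw_of_roughStub hf (by linarith)
        (stub_roughKernel_quadratic f hf h0 y hy hy'))
      (fun k f hf h3 y hy hy' => betaKernelLaw_of_roughStub hf (by linarith)
        (stub_roughKernel_totalDegree k f hf h3 y hy hy')))

end

end Summit.Parity.BatemanHorn.Cruxes.SystemLSDRealSegment.BetaThinnedRootKernel
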